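import Mathlib

/-!
# Existence of the spot decomposition — line «sfm-bl» (PROOF-SFM-BL §5 step (1), SPOT EXTRACTION, as a theorem)

FRONTIER F-N1c; nothing here bears on P vs NP.

The extraction loop of PROOF-SFM-BL §5 (1): «while some `G`-connected pair `(W₁, W₂)` with
`|W₁| + |W₂| ≤ t₀` carries more than `γ·√(|W₁||W₂|)` legs of the current remainder, move those legs into
a new spot».  This file proves, by strong induction on the number of legs, that the loop's OUTPUT EXISTS
(no complexity claim): for any finite leg set `R` (legs `e : Λ` with endpoints `src e : α`, `dst e : β`),
any graph `G` on `α ⊕ β` (only used to say which pairs are «connected»), any `γ ≥ 0` and `t₀`, there are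
a number of spots `r`, a labelling `p : Λ → Option (Fin r)` (`none` = remainder) and sides
`V₁ s ⊆ α`, `V₂ s ⊆ β` such that

* (sparse) every `G`-connected pair of total size `≤ t₀` carries `≤ γ√(|W₁||W₂|)` remainder legs of `R`;
* (sides) every leg of spot `s` (in `R`) goes from `V₁ s` to `V₂ s`;
* (dense) spot `s` has `> γ√(|V₁ s||V₂ s|)` legs in `R`;
* (small) `|V₁ s| + |V₂ s| ≤ t₀`;
* (covered) `|V₁ s| + |V₂ s| ≤ 2·#(legs of spot s in R)` (the sides are the endpoint sets of the spot).

`exists_spot_decomposition` is the general statement (relative to `R`), `exists_spot_decomposition_univ`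
the one used downstream (`R = univ`).  Definition-free.
-/

namespace Summit.PneNP.PneNP.Theorems.SfmBl

open Finset BigOperators

/-- SPOT EXTRACTION TERMINATES WITH A DECOMPOSITION (relative form, any leg set `R`). -/
theorem exists_spot_decomposition {α β Λ : Type*} [Fintype Λ] [DecidableEq α] [DecidableEq β]
    [DecidableEq Λ] (src : Λ → α) (dst : Λ → β) (G : SimpleGraph (α ⊕ β)) {γ : ℝ} (hγ : 0 ≤ γ)
    (t₀ : ℕ) (R : Finset Λ) :
    ∃ (r : ℕ) (p : Λ → Option (Fin r)) (V₁ : Fin r → Finset α) (V₂ : Fin r → Finset β),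
      (∀ (W₁ : Finset α) (W₂ : Finset β),
          (G.induce {x | Sum.elim (fun i => i ∈ W₁) (fun j => j ∈ W₂) x}).Connected →
          W₁.card + W₂.card ≤ t₀ →
          ((R.filter fun e => p e = none ∧ src e ∈ W₁ ∧ dst e ∈ W₂).card : ℝ)
            ≤ γ * Real.sqrt ((W₁.card : ℝ) * (W₂.card : ℝ))) ∧
      (∀ s, ∀ e ∈ R, p e = some s → src e ∈ V₁ s ∧ dst e ∈ V₂ s) ∧
      (∀ s, γ * Real.sqrt (((V₁ s).card : ℝ) * ((V₂ s).card : ℝ))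
          < ((R.filter fun e => p e = some s).card : ℝ)) ∧
      (∀ s, (V₁ s).card + (V₂ s).card ≤ t₀) ∧
      (∀ s, (V₁ s).card + (V₂ s).card ≤ 2 * (R.filter fun e => p e = some s).card) := by
  classical
  -- strong induction on the number of legs of `R`
  induction' hR : R.card using Nat.strong_induction_on with N ih generalizing R
  by_cases hsparse : ∀ (W₁ : Finset α) (W₂ : Finset β),
      (G.induce {x | Sum.elim (fun i => i ∈ W₁) (fun j => j ∈ W₂) x}).Connected →
      W₁.card + W₂.card ≤ t₀ →
      ((R.filter fun e => src e ∈ W₁ ∧ dst e ∈ W₂).card : ℝ)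
        ≤ γ * Real.sqrt ((W₁.card : ℝ) * (W₂.card : ℝ))
  · -- already sparse: no spots
    refine ⟨0, fun _ => none, Fin.elim0, Fin.elim0, ?_, ?_, ?_, ?_, ?_⟩
    · intro W₁ W₂ hconn hsize
      have : (R.filter fun e => (none : Option (Fin 0)) = none ∧ src e ∈ W₁ ∧ dst e ∈ W₂)
          = (R.filter fun e => src e ∈ W₁ ∧ dst e ∈ W₂) := Finset.filter_congr fun e _ => by simp
      rw [this]; exact hsparse W₁ W₂ hconn hsize
    · intro s; exact Fin.elim0 s
    · intro s; exact Fin.elim0 s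
    · intro s; exact Fin.elim0 s
    · intro s; exact Fin.elim0 s
  · -- extract one dense small connected pair
    push Not at hsparse
    obtain ⟨W₁, W₂, hconn, hsize, hdense⟩ := hsparse
    set S : Finset Λ := R.filter fun e => src e ∈ W₁ ∧ dst e ∈ W₂ with hS
    have hSsub : S ⊆ R := Finset.filter_subset _ _
    have hSne : S.Nonempty := by
      rw [Finset.nonempty_iff_ne_empty]
      intro h0
      rw [h0, Finset.card_empty, Nat.cast_zero] at hdense
      exact absurd hdense (not_lt.2 (mul_nonneg hγ (Real.sqrt_nonneg _)))
    have hlt : (R \ S).card < N := by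
      rw [← hR, Finset.card_sdiff_of_subset hSsub]
      have h1 : 0 < S.card := Finset.card_pos.2 hSne
      have h2 : S.card ≤ R.card := Finset.card_le_card hSsub
      omega
    obtain ⟨r', p', V₁', V₂', hsp', hsides', hdense', hsmall', hcov'⟩ := ih _ hlt (R \ S) rfl
    -- the new decomposition: spot `Fin.last r'` is `S`, old spots are shifted by `castSucc`
    let p : Λ → Option (Fin (r' + 1)) := fun e =>
      if e ∈ S then some (Fin.last r') else (p' e).map Fin.castSucc
    let V₁ : Fin (r' + 1) → Finset α := Fin.snoc V₁' (S.image src)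
    let V₂ : Fin (r' + 1) → Finset β := Fin.snoc V₂' (S.image dst)
    -- bookkeeping of the labels
    have hp_none : ∀ e, p e = none ↔ e ∉ S ∧ p' e = none := by
      intro e; by_cases he : e ∈ S
      · simp [p, he]
      · simp [p, he]
    have hp_last : ∀ e, p e = some (Fin.last r') ↔ e ∈ S := by
      intro e; by_cases he : e ∈ S
      · simp [p, he]
      · simp only [p, he, if_false]
        cases h' : p' e with
        | none => simp
        | some s' => simp [Fin.castSucc_lt_last s' |>.ne]
    have hp_cast : ∀ e (s' : Fin r'), p e = some (Fin.castSucc s') ↔ e ∉ S ∧ p' e = some s' := by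
      intro e s'; by_cases he : e ∈ S
      · simp only [p, he, if_true, Option.some.injEq, not_true_eq_false, false_and, iff_false]
        exact fun h => (Fin.castSucc_lt_last s').ne (h ▸ rfl)
      · simp only [p, he, if_false, not_false_eq_true, true_and]
        cases h' : p' e with
        | none => simp
        | some s'' => simp [Fin.castSucc_inj]
    -- legs of `R` with a given label
    have hfilt_last : (R.filter fun e => p e = some (Fin.last r')) = S := by
      ext e; simp only [Finset.mem_filter, hp_last]
      exact ⟨fun h => h.2, fun h => ⟨hSsub h, h⟩⟩
    have hfilt_cast : ∀ s' : Fin r', (R.filter fun e => p e = some (Fin.castSucc s'))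
        = ((R \ S).filter fun e => p' e = some s') := by
      intro s'; ext e
      simp only [Finset.mem_filter, Finset.mem_sdiff, hp_cast]
      tauto
    refine ⟨r' + 1, p, V₁, V₂, ?_, ?_, ?_, ?_, ?_⟩
    · -- sparse: the new remainder inside `R` is the old remainder inside `R \ S`
      intro U₁ U₂ hc hsz
      have : (R.filter fun e => p e = none ∧ src e ∈ U₁ ∧ dst e ∈ U₂)
          = ((R \ S).filter fun e => p' e = none ∧ src e ∈ U₁ ∧ dst e ∈ U₂) := by
        ext e
        simp only [Finset.mem_filter, Finset.mem_sdiff, hp_none]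
        tauto
      rw [this]; exact hsp' U₁ U₂ hc hsz
    · -- sides
      intro s e he hpe
      induction s using Fin.lastCases with
      | last =>
        have heS : e ∈ S := (hp_last e).1 hpe
        simp only [V₁, V₂, Fin.snoc_last]
        exact ⟨Finset.mem_image_of_mem _ heS, Finset.mem_image_of_mem _ heS⟩
      | cast s' =>
        obtain ⟨heS, hpe'⟩ := (hp_cast e s').1 hpe
        simp only [V₁, V₂, Fin.snoc_castSucc]
        exact hsides' s' e (Finset.mem_sdiff.2 ⟨he, heS⟩) hpe'
    · -- dense
      intro s
      induction s using Fin.lastCases with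
      | last =>
        rw [hfilt_last]
        simp only [V₁, V₂, Fin.snoc_last]
        refine lt_of_le_of_lt ?_ hdense
        refine mul_le_mul_of_nonneg_left (Real.sqrt_le_sqrt ?_) hγ
        have h1 : ((S.image src).card : ℝ) ≤ W₁.card := by
          exact_mod_cast Finset.card_le_card fun i hi => by
            obtain ⟨e, he, rfl⟩ := Finset.mem_image.1 hi
            exact (Finset.mem_filter.1 he).2.1
        have h2 : ((S.image dst).card : ℝ) ≤ W₂.card := by
          exact_mod_cast Finset.card_le_card fun k hk => by
            obtain ⟨e, he, rfl⟩ := Finset.mem_image.1 hk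
            exact (Finset.mem_filter.1 he).2.2
        exact mul_le_mul h1 h2 (Nat.cast_nonneg _) (Nat.cast_nonneg _)
      | cast s' =>
        rw [hfilt_cast s']
        simp only [V₁, V₂, Fin.snoc_castSucc]
        exact hdense' s'
    · -- small
      intro s
      induction s using Fin.lastCases with
      | last =>
        simp only [V₁, V₂, Fin.snoc_last]
        have h1 : (S.image src).card ≤ W₁.card := Finset.card_le_card fun i hi => by
          obtain ⟨e, he, rfl⟩ := Finset.mem_image.1 hi
          exact (Finset.mem_filter.1 he).2.1
        have h2 : (S.image dst).card ≤ W₂.card := Finset.card_le_card fun k hk => by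
          obtain ⟨e, he, rfl⟩ := Finset.mem_image.1 hk
          exact (Finset.mem_filter.1 he).2.2
        omega
      | cast s' =>
        simp only [V₁, V₂, Fin.snoc_castSucc]
        exact hsmall' s'
    · -- covered
      intro s
      induction s using Fin.lastCases with
      | last =>
        rw [hfilt_last]
        simp only [V₁, V₂, Fin.snoc_last]
        have h1 : (S.image src).card ≤ S.card := Finset.card_image_le
        have h2 : (S.image dst).card ≤ S.card := Finset.card_image_le
        omega
      | cast s' =>
        rw [hfilt_cast s']
        simp only [V₁, V₂, Fin.snoc_castSucc]
        exact hcov' s'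

/-- SPOT EXTRACTION FROM ALL LEGS (`R = univ`): the form used by the sfm-bl assembly. -/
theorem exists_spot_decomposition_univ {α β Λ : Type*} [Fintype Λ] [DecidableEq α] [DecidableEq β]
    [DecidableEq Λ] (src : Λ → α) (dst : Λ → β) (G : SimpleGraph (α ⊕ β)) {γ : ℝ} (hγ : 0 ≤ γ)
    (t₀ : ℕ) :
    ∃ (r : ℕ) (p : Λ → Option (Fin r)) (V₁ : Fin r → Finset α) (V₂ : Fin r → Finset β),
      (∀ (W₁ : Finset α) (W₂ : Finset β),
          (G.induce {x | Sum.elim (fun i => i ∈ W₁) (fun j => j ∈ W₂) x}).Connected →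
          W₁.card + W₂.card ≤ t₀ →
          ((Finset.univ.filter fun e => p e = none ∧ src e ∈ W₁ ∧ dst e ∈ W₂).card : ℝ)
            ≤ γ * Real.sqrt ((W₁.card : ℝ) * (W₂.card : ℝ))) ∧
      (∀ s e, p e = some s → src e ∈ V₁ s ∧ dst e ∈ V₂ s) ∧
      (∀ s, γ * Real.sqrt (((V₁ s).card : ℝ) * ((V₂ s).card : ℝ))
          < ((Finset.univ.filter fun e => p e = some s).card : ℝ)) ∧
      (∀ s, (V₁ s).card + (V₂ s).card ≤ t₀) ∧
      (∀ s, (V₁ s).card + (V₂ s).card ≤ 2 * (Finset.univ.filter fun e => p e = some s).card) := by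
  obtain ⟨r, p, V₁, V₂, h1, h2, h3, h4, h5⟩ :=
    exists_spot_decomposition src dst G hγ t₀ (Finset.univ : Finset Λ)
  exact ⟨r, p, V₁, V₂, h1, fun s e he => h2 s e (Finset.mem_univ e) he, h3, h4, h5⟩

end Summit.PneNP.PneNP.Theorems.SfmBl
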